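import Literature.AlgebraicGeometry.AbelianSchemes.PolarizedTripleRigidity
import Literature.AlgebraicGeometry.AbelianSchemes.IsLambdaOfAtOfIsBaseChangeVia
import Literature.AlgebraicGeometry.AbelianSchemes.IsLambdaOfAtWitnessCongruence
import Literature.AlgebraicGeometry.AbelianSchemes.FibrePointsMulEquivPoints
import Literature.AlgebraicGeometry.AbelianSchemes.AbelianSchemeDualTransport
import HarnessLib

/-!
# Rigidity of triples over `Spec Ω` REDUCES TO THE FIBRE: the lemma of Serre for polarised triples follows from its
# abelian-VARIETY form ([Milne1986AbelianVarieties, Prop. 17.5 (b)]; [MumfordFogartyKirwan1994, Ch. 7 §3 p. 139])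

Sequel of ★ `PolarizedTripleRigidity` (cell hodgecm-mathlib, F-DAG leaf F-7 (7b) / F-8 (8e), layer (L2a); seat B-p03 (g17)).
★ `PolarizedTripleRigidity` reduces «every automorphism `(G, Ĝ)` of a triple `P` over a locally Noetherian base is trivial»
BY NAME to the socket «triples over `Spec Ω` are rigid» (`∀ Q H Ĥ, Q.IsBaseChangeVia Q (𝟙 (Spec Ω)) H Ĥ → H = 𝟙`) at the
geometric points.  THIS FILE reduces that socket further, from the scheme-theoretic triple
`Q : PolarizedAbelianSchemeWithLevel g N δ (Spec Ω)` to its FIBRE ABELIAN VARIETY `Q.A_s` (`(Q.A.fibre s).toAbelianVariety :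
Motives.AbelianVariety Ω`), i.e. to [Milne1986AbelianVarieties, Prop. 17.5 (b)] in the tree's variety currency:

  (FB′) for every abelian variety `B` over `Ω`, every automorphism `e : B ≅ B`, and every AMPLE Cartier divisor `Θ` with
  `t_Q^*(Θ − e^*Θ) ∼ Θ − e^*Θ` for all points `Q ∈ B(Ω)` ([MumfordAV1970] §8: `Θ − e^*Θ ∈ Pic⁰`, i.e. `e` preserves the
  polarisation `Λ(𝒪(Θ))`), if `e` fixes the `N`-torsion points `B[N](Ω)` then `e = 𝟙`

— which is the statement the ANALYTIC road proves at `Ω = ℂ` (★ `Motives.AbelianVarietyAmpleRiemannForm`,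
★ `Geometry.Kaehler.ComplexTorusPolarizedAutomorphisms.eq_one_of_mem_polarizedAut_of_dvd_sub_one`, ★
`HodgeTheory.AbelianVarietyPolarizedAutomorphisms`; layer (L2b), another hand).

Proof of the reduction (all bricks ★): the automorphism `(H, Ĥ)` of `Q` along `𝟙 (Spec Ω)` is an isomorphism of group
schemes `e₀ : X ≅ X` (cartesian square over `𝟙`; unit/law clauses = `IsMonHom`), whence the fibre automorphism
`e := fibreIsoOfIso e₀ s` of `Q.A_s` (★ `AbelianSchemeDualTransport`); an ample witness `Θ` of `λ̄ = Λ(𝒪(Θ))` at `s` (★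
`Polarization.exists_ample`) transports along the automorphism to the witness `e^*Θ` of the SAME `λ̄` (★
`IsBaseChangeVia.isLambdaOfAt_of_fibreIso`, the Poincaré and `λ`-clauses of `IsBaseChangeVia`), so `t_Q^*(Θ − e^*Θ) ∼ Θ − e^*Θ`
(★ `IsLambdaOfAt.linEquiv_pullback_translation_sub`); the level clause `σᵢ ≫ H = σᵢ` makes `e` fix the `N`-torsion points
(every one is a `σ^a(s)`, ★ `LevelStructure.basis_surjective`, read through ★ `exists_mulEquiv_fibrePoints_points` and ★
`sectionPow_comp_of_isMonHom`); (FB′) gives `e = 𝟙`, i.e. `H ×_S Spec Ω = 𝟙`, and rigidity of homomorphisms (★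
`hom_eq_of_pullback_map_eq_of_isLocallyNoetherian`) gives `H = 𝟙`.

* `rigid_of_forall_abelianVariety` — (FB′) at `Ω` (algebraically closed) ⇒ triples over `Spec Ω` are rigid;
* `eq_id_and_hat_eq_id_of_forall_abelianVariety` — composed with ★ `PolarizedTripleRigidity`: (FB′) at every algebraically
  closed `Ω → S` ⇒ every automorphism of a triple over a locally Noetherian `S` is `(𝟙, 𝟙)`;
* `eq_id_and_hat_eq_id_of_forall_residueField` — the residue-field form of the spreading theorem (hypothesis: rigidity over
  `Spec κ(z)` for the points `z` of `X`; for `X` of finite type over `ℚ` these embed in `ℂ`, ★ `rigid_of_rigid_extension`).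

Theorems only (no definition, no named fact, no instance, no `sorry`).  HC_CM is proved only modulo the 7 printed citations
until rung 0 closes; this file discharges none of them.

## References
* [MumfordFogartyKirwan1994] D. Mumford, J. Fogarty, F. Kirwan, *Geometric Invariant Theory*, 3rd ed. (1994), Ch. 6 §1
  Cor. 6.2 (p. 116), §2 Def. 6.2–6.3 (p. 120); Ch. 7 §2 Def. 7.1–7.3 (p. 129); §3, remark after Thm. 7.9 (p. 139).
* [Milne1986AbelianVarieties] J. S. Milne, Abelian varieties, in Cornell–Silverman (1986), Prop. 17.5 (p. 139).
* [MumfordAV1970] D. Mumford, *Abelian Varieties* (1970), §8 (the class of `t_x^*D − D`), §13 (`K(L)`).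
-/

set_option autoImplicit false

noncomputable section

universe u

open CategoryTheory CategoryTheory.Limits AlgebraicGeometry MonoidalCategory CartesianMonoidalCategory
open scoped MonObj

namespace Literature.AlgebraicGeometry.AbelianSchemes

open Literature.AlgebraicGeometry.Motives

namespace PolarizedAbelianSchemeWithLevel

variable {g N : ℕ} {δ : Fin g → ℕ}

/-- **Rigidity of triples over `Spec Ω` reduces to the fibre abelian variety** ([Milne1986AbelianVarieties] Prop. 17.5 (b) in
variety currency ⇒ [Deligne1971TravauxShimura] 4.16 / [MumfordFogartyKirwan1994] p. 139 for triples over `Spec Ω`): if every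
automorphism of every abelian variety over the algebraically closed field `Ω` which preserves the polarisation of some ample
`Θ` (`t_Q^*(Θ − e^*Θ) ∼ Θ − e^*Θ` for all `Q`) and fixes the `N`-torsion points is the identity, then every automorphism
`(H, Ĥ)` of a polarised abelian scheme of type `δ` with level-`N` structure over `Spec Ω` has `H = 𝟙`.
[cite: Milne1986AbelianVarieties, Prop. 17.5 (b) (p. 139)] [cite: MumfordFogartyKirwan1994, Ch. 7 §3, remark after Theorem 7.9 (p. 139); Ch. 6 §2 Definition 6.2–6.3 (p. 120)]
[cite: MumfordAV1970, §8 (the divisor class `t_x^*D − D`)] -/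
theorem rigid_of_forall_abelianVariety {Ω : Type u} [Field Ω] [IsAlgClosed Ω]
    (hFB : ∀ (B : AbelianVariety Ω) (e : B ≅ B) (Θ : CartierDivisor B.X.left), Θ.IsAmple →
      (haveI := AbelianVariety.isDominant_toSchemeHom_iso_hom e
       ∀ Q : B.Points Ω, ((Θ + -Θ.pullback (AbelianVariety.Hom.toSchemeHom e.hom)).pullback
          (B.translation Q).left).LinEquiv (Θ + -Θ.pullback (AbelianVariety.Hom.toSchemeHom e.hom))) →
      (∀ P : B.Points Ω, P ^ N = 1 → AlgPoints.map e.hom.hom.hom.hom P = P) → e.hom = 𝟙 B)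
    (Q : PolarizedAbelianSchemeWithLevel g N δ (Spec (.of Ω))) {H : Q.A.X.left ⟶ Q.A.X.left}
    {Ĥ : Q.D.hat.X.left ⟶ Q.D.hat.X.left} (h : Q.IsBaseChangeVia Q (𝟙 _) H Ĥ) : H = 𝟙 Q.A.X.left := by
  -- §a the automorphism as an isomorphism of group schemes over `Spec Ω`
  obtain ⟨w, hpb, hη, hμ⟩ := h.1.1
  haveI : IsIso H := hpb.isIso_fst_of_isIso
  have w' : H ≫ Q.A.X.hom = Q.A.X.hom := by rw [w, Category.comp_id]
  let e₀ : Q.A.X ≅ Q.A.X := Over.isoMk (asIso H) w'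
  haveI : IsMonHom e₀.hom :=
    { one_hom := by
        ext
        rw [Over.comp_left]
        change η[Q.A.X].left ≫ H = η[Q.A.X].left
        rw [hη]
        exact Category.id_comp _
      mul_hom := by
        ext
        rw [Over.comp_left, Over.comp_left, Over.tensorHom_left]
        exact hμ }
  have hfix : ∀ i, Q.level.σ i ≫ e₀.hom = Q.level.σ i := fun i => by
    ext
    rw [Over.comp_left]
    change (Q.level.σ i).left ≫ H = (Q.level.σ i).left
    rw [h.1.2 i]
    exact Category.id_comp _
  -- §b the fibre automorphism at the geometric point `s = 𝟙`
  let s : Spec (.of Ω) ⟶ Spec (.of Ω) := 𝟙 _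
  let B : AbelianVariety Ω := (Q.A.fibre s).toAbelianVariety
  let e : B ≅ B := AbelianSchemeOver.fibreIsoOfIso e₀ s
  have he : AbelianVariety.Hom.toSchemeHom e.hom ≫ pullback.fst Q.A.X.hom s = pullback.fst Q.A.X.hom s ≫ H :=
    AbelianSchemeOver.fibreIsoOfIso_hom_toSchemeHom_fst e₀ s
  -- §c an ample witness `Θ` of `λ̄` at `s` and its transport `e^*Θ`, a witness of the SAME `λ̄`
  obtain ⟨Θ, hΘ, hΛ⟩ := Q.pol.exists_ample Ω s
  haveI := AbelianVariety.isDominant_toSchemeHom_iso_hom e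
  have hΛ' : Q.A.IsLambdaOfAt s Q.D Q.pol.lam (Θ.pullback (AbelianVariety.Hom.toSchemeHom e.hom)) := by
    have gen : ∀ (e' : (Q.A.fibre s).toAbelianVariety ≅ (Q.A.fibre (s ≫ 𝟙 _)).toAbelianVariety)
        (he' : AbelianVariety.Hom.toSchemeHom e'.hom ≫ pullback.fst Q.A.X.hom (s ≫ 𝟙 _) = pullback.fst Q.A.X.hom s ≫ H)
        (Θ' : CartierDivisor (Q.A.fibre (s ≫ 𝟙 _)).toAbelianVariety.X.left),
        Q.A.IsLambdaOfAt (s ≫ 𝟙 _) Q.D Q.pol.lam Θ' →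
          haveI := AbelianVariety.isDominant_toSchemeHom_iso_hom e'
          Q.A.IsLambdaOfAt s Q.D Q.pol.lam (Θ'.pullback (AbelianVariety.Hom.toSchemeHom e'.hom)) :=
      fun e' he' Θ' hΛ' => h.isLambdaOfAt_of_fibreIso s e' he' Θ' hΛ'
    rw [Category.comp_id] at gen
    exact gen e he Θ hΛ
  have hlin : ∀ P : B.Points Ω, ((Θ + -Θ.pullback (AbelianVariety.Hom.toSchemeHom e.hom)).pullback
      (B.translation P).left).LinEquiv (Θ + -Θ.pullback (AbelianVariety.Hom.toSchemeHom e.hom)) :=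
    fun P => hΛ.linEquiv_pullback_translation_sub hΛ' P
  -- §d `e` fixes the `N`-torsion points (they are the `σ^a(s)`)
  obtain ⟨ε, hε⟩ := Q.A.exists_mulEquiv_fibrePoints_points s
  have htors : ∀ P : B.Points Ω, P ^ N = 1 → AlgPoints.map e.hom.hom.hom.hom P = P := by
    intro P hP
    have hu : ε.symm P ^ N = 1 := by rw [← map_pow, hP, map_one]
    obtain ⟨a, ha⟩ := Q.level.basis_surjective s (ε.symm P) hu
    -- `P = σ^a(s)`
    have hPeq : P = Q.A.restrictPt s (Q.A.sectionPow Q.level.σ a) := by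
      apply Q.A.fibrePointToLeft_injective s
      rw [AbelianSchemeOver.fibrePointToLeft_restrictPt, ha, ← hε (ε.symm P), MulEquiv.apply_symm_apply]
    -- `σ^a ≫ e₀ = σ^a`
    have hσa : (Q.A.sectionPow Q.level.σ a).left ≫ e₀.hom.left = (Q.A.sectionPow Q.level.σ a).left := by
      rw [← Over.comp_left, Q.A.sectionPow_comp_of_isMonHom e₀.hom Q.level.σ a]
      congr 2
      funext i
      exact hfix i
    rw [hPeq]
    apply Q.A.fibrePointToLeft_injective s
    rw [AbelianSchemeOver.fibreIsoOfIso_hom_eq_fibreHom, AbelianSchemeOver.fibrePointToLeft_map_fibreHom]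
    change ((Q.A.restrictPt s (Q.A.sectionPow Q.level.σ a)).left ≫ pullback.fst Q.A.X.hom s) ≫ e₀.hom.left =
      (Q.A.restrictPt s (Q.A.sectionPow Q.level.σ a)).left ≫ pullback.fst Q.A.X.hom s
    rw [AbelianSchemeOver.restrictPt_left_fst]
    erw [Category.assoc, hσa]
    exact (Category.id_comp _).symm
  -- §e the field brick: `e = 𝟙`
  have he1 : e.hom = 𝟙 B := hFB B e Θ hΘ hlin htors
  -- §f back to `H`: `H ×_S Spec Ω = 𝟙`, rigidity of homomorphisms
  have hmap : (Over.pullback s).map e₀.hom = (Over.pullback s).map (𝟙 Q.A.X) := by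
    have h1 := congrArg (fun f => f.hom.hom.hom) he1
    dsimp only at h1
    rw [AbelianSchemeOver.fibreIsoOfIso_hom_eq_fibreHom, AbelianSchemeOver.fibreHom_hom_hom_hom] at h1
    rw [h1, CategoryTheory.Functor.map_id]
    rfl
  haveI := Q.A.isSeparated_hom
  haveI : PreconnectedSpace ↥(Spec (CommRingCat.of Ω)) :=
    ⟨(PreirreducibleSpace.isPreirreducible_univ (X := ↥(Spec (CommRingCat.of Ω)))).isPreconnected⟩
  have hE0 : e₀.hom = 𝟙 Q.A.X := Q.A.hom_eq_of_pullback_map_eq_of_isLocallyNoetherian e₀.hom (𝟙 Q.A.X) s hmap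
  exact congrArg CommaMorphism.left hE0

/-- **Hence: (FB′) at every algebraically closed `Ω → S` makes every automorphism of a triple over a locally Noetherian
`S` trivial** (`G = 𝟙`, `Ĝ = 𝟙`; ★ `eq_id_and_hat_eq_id_of_forall_geometricPoint` ∘ `rigid_of_forall_abelianVariety`).
[cite: MumfordFogartyKirwan1994, Ch. 7 §3, remark after Theorem 7.9 (p. 139)] [cite: Milne1986AbelianVarieties, Prop. 17.5 (b) (p. 139)] -/
theorem eq_id_and_hat_eq_id_of_forall_abelianVariety {S : Scheme.{u}} [IsLocallyNoetherian S]
    (P : PolarizedAbelianSchemeWithLevel g N δ S)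
    (hS : ∀ ⦃Ω : Type u⦄ [Field Ω] [IsAlgClosed Ω] (_t : Spec (.of Ω) ⟶ S)
      (B : AbelianVariety Ω) (e : B ≅ B) (Θ : CartierDivisor B.X.left), Θ.IsAmple →
      (haveI := AbelianVariety.isDominant_toSchemeHom_iso_hom e
       ∀ Q : B.Points Ω, ((Θ + -Θ.pullback (AbelianVariety.Hom.toSchemeHom e.hom)).pullback
          (B.translation Q).left).LinEquiv (Θ + -Θ.pullback (AbelianVariety.Hom.toSchemeHom e.hom))) →
      (∀ P : B.Points Ω, P ^ N = 1 → AlgPoints.map e.hom.hom.hom.hom P = P) → e.hom = 𝟙 B)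
    {G : P.A.X.left ⟶ P.A.X.left} {Ĝ : P.D.hat.X.left ⟶ P.D.hat.X.left} (h : P.IsBaseChangeVia P (𝟙 S) G Ĝ) :
    G = 𝟙 P.A.X.left ∧ Ĝ = 𝟙 P.D.hat.X.left :=
  P.eq_id_and_hat_eq_id_of_forall_geometricPoint
    (fun _ _ _ t Q _ _ hQ => rigid_of_forall_abelianVariety (hS t) Q hQ) h


/-! ### Residue-field form of ★ `eq_id_of_isBaseChangeVia_id_of_forall_geometricPoint` (for bases of finite type over `ℚ`,
whose residue fields embed in `ℂ`, so that ★ `rigid_of_rigid_extension` feeds it from rigidity over `Spec ℂ`) -/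

/-- **Rigidity spreads from the RESIDUE FIELDS of the total space** (any locally Noetherian base, no connectedness): if the
triples over `Spec κ(z)` are rigid for every point `z` of `X`, then every automorphism `(G, Ĝ)` of the triple has `G = 𝟙` and
`Ĝ = 𝟙` — the all-fibres engine ★ `hom_eq_of_forall_fromSpecResidueField_comp_eq_of_stein` fed by ★
`pullback_fst_comp_eq_of_isBaseChangeVia_id` at `Spec κ(z) → S`.  (For `X` of finite type over `ℚ` every `κ(z)` embeds in `ℂ`,
so ★ `rigid_of_rigid_extension` reduces the hypothesis to rigidity over `Spec ℂ`.)
[cite: MumfordFogartyKirwan1994, Ch. 6 §1 Corollary 6.2 (p. 116); Ch. 7 §3, remark after Theorem 7.9 (p. 139)] -/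
theorem eq_id_and_hat_eq_id_of_forall_residueField {S : Scheme.{u}} [IsLocallyNoetherian S]
    (P : PolarizedAbelianSchemeWithLevel g N δ S)
    (hS : ∀ z : ↥P.A.X.left, ∀ (Q : PolarizedAbelianSchemeWithLevel g N δ (Spec (P.A.X.left.residueField z)))
      (H : Q.A.X.left ⟶ Q.A.X.left) (Ĥ : Q.D.hat.X.left ⟶ Q.D.hat.X.left), Q.IsBaseChangeVia Q (𝟙 _) H Ĥ → H = 𝟙 _)
    {G : P.A.X.left ⟶ P.A.X.left} {Ĝ : P.D.hat.X.left ⟶ P.D.hat.X.left} (h : P.IsBaseChangeVia P (𝟙 S) G Ĝ) :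
    G = 𝟙 P.A.X.left ∧ Ĝ = 𝟙 P.D.hat.X.left := by
  suffices hG : G = 𝟙 P.A.X.left from ⟨hG, P.hat_eq_id_of_isBaseChangeVia_id h hG⟩
  obtain ⟨w, -, hη, hμ⟩ := h.1.1
  have w' : G ≫ P.A.X.hom = P.A.X.hom := by rw [w, Category.comp_id]
  let u : P.A.X ⟶ P.A.X := Over.homMk G w'
  haveI : IsMonHom u :=
    { one_hom := by
        ext
        rw [Over.comp_left]
        erw [hη]
        exact Category.id_comp _
      mul_hom := by
        ext
        rw [Over.comp_left, Over.comp_left, Over.tensorHom_left]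
        exact hμ }
  haveI := P.A.universallyClosed_hom
  have hu : u = 𝟙 P.A.X := by
    refine AbelianSchemeOver.hom_eq_of_forall_fromSpecResidueField_comp_eq_of_stein
      P.A.app_bijective_of_isLocallyNoetherian η[P.A.X] u (𝟙 P.A.X) (fun z => ?_)
      (by rw [IsMonHom.one_hom, Category.comp_id])
    let K : Type u := ↥(P.A.X.left.residueField z)
    let t : Spec (.of K) ⟶ S := P.A.X.left.fromSpecResidueField z ≫ P.A.X.hom
    have hfst := P.pullback_fst_comp_eq_of_isBaseChangeVia_id t (hS z) h
    have hlift : pullback.lift (P.A.X.left.fromSpecResidueField z) (𝟙 _) (by simp [t]) ≫ pullback.fst P.A.X.hom t =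
        P.A.X.left.fromSpecResidueField z := pullback.lift_fst _ _ _
    change P.A.X.left.fromSpecResidueField z ≫ G = P.A.X.left.fromSpecResidueField z ≫ 𝟙 _
    rw [Category.comp_id, ← hlift, Category.assoc, hfst]
  exact congrArg CommaMorphism.left hu

end PolarizedAbelianSchemeWithLevel

end Literature.AlgebraicGeometry.AbelianSchemes

end
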